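import Mathlib.Algebra.MvPolynomial.Eval
import Literature.Computability.AlgebraicComplexity.FlatteningBound
import Literature.Computability.Complexity.NullstellensatzRefutation
import HarnessLib

/-!
# The Brent equations `B(n, r)` for `⟨n,n,n⟩` and their Nullstellensatz refutations

Topic: `Literature/Computability/AlgebraicComplexity`. Definition request `defn-HasNSRefutation`
(route MatrixMultiplication/BrentRefutationDepth, items `stmt-MatrixMultiplication-5580…5588`):
"two definitions so that refutation-depth statements stop inlining the Brent system".

## What is here (definitions with bodies + proved API; no named facts)

* `brentSystem K n r : (Fin n × Fin n) → (Fin n × Fin n) → (Fin n × Fin n) → K[X_{(s,t,e)}]` —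
  **the Brent system `B(n, r)`** (Brent 1970; Heule–Kauers–Seidl 2021, §2: the "Brent equations"
  `∑_{ℓ ≤ r} α^{(ℓ)}_{i₁i₂} β^{(ℓ)}_{j₁j₂} γ^{(ℓ)}_{k₁k₂} = δ_{i₂,j₁} δ_{i₁,k₁} δ_{j₂,k₂}`, `n⁶` cubic
  equations in `3rn²` unknowns): equation `(i, j, k)` is
  `∑_{t<r} X(0,t,i)·X(1,t,j)·X(2,t,k) - C ⟨n,n,n⟩_{ijk}` with `⟨n,n,n⟩ = matMulTensor K n n n`
  (Bläser 2013, §5) — VERBATIM the expression the route's items inline, so that they are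
  definitionally statements about `brentSystem` (checked in a scratch file against
  `TwoBySixDepth`, `RefutationSound`, `NSDepthLowerBound`).
* `HasBrentRefutation K n r D` — **`B(n, r)` has a Nullstellensatz refutation with multipliers of
  total degree `≤ D`** (`D_NS(n, r) ≤ D`): the tree's general notion
  `Literature.Computability.Complexity.HasNSRefutationWithMultipliersOfDegree`
  (`NullstellensatzRefutation.lean`; Krajíček §6.2) applied to the triple-indexed Brent system —
  the requested `HasNSRefutation S D := ∃ g, (∀ e, deg (g e) ≤ D) ∧ ∑ g e · S e = 1` IS that
  existing notion (`hasNSRefutationWithMultipliersOfDegree_iff_forall`), not redefined here;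
  `hasBrentRefutation_iff` is the curried form `∃ g, (∀ i j k, deg ≤ D) ∧ ∑ i, ∑ j, ∑ k, g·B = 1`
  of the route (e.g. `TwoBySixDepth ↔ HasBrentRefutation ℂ 2 6 12` by `.symm`).
* Proved: `eval_brentSystem` (zeros of `B(n,r)` = decompositions into `r` triads),
  `tensorRank_le_iff_exists_brent_zero` (**`B(n, r)` solvable over `K` iff `R_K(⟨n,n,n⟩) ≤ r`**,
  via the padding lemma `tensorRank_le_iff`), the soundness of NS refutations
  `HasNSRefutationWithMultipliersOfDegree.exists_eval_ne_zero` (no common zero), and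
  **`HasBrentRefutation.lt_tensorRank`**: a refutation of `B(n, r)` certifies `r < R(⟨n,n,n⟩)`
  (the route's item `RefutationSound` in one line); `HasBrentRefutation.mono`.

Not here (requested as "wanted", left to provers): invariance of refutability under the torus
`(Kˣ)^{2r}` / the weight-`0` projection of multipliers (a graded-ring argument), the PHP lower
bound on `D_NS`, any concrete certificate.

## References

* R. P. Brent, *Algorithms for matrix multiplication*, Tech. Report STAN-CS-70-157, Stanford
  (1970). [Brent1970]
* M. J. H. Heule, M. Kauers, M. Seidl, *New ways to multiply 3 × 3-matrices*, J. Symbolic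
  Comput. 104 (2021) 899–916, arXiv:1905.10192, §2 "The Brent equations". [HeuleKauersSeidl2021]
* M. Bläser, *Fast Matrix Multiplication*, Theory of Computing Graduate Surveys 5 (2013), Def. 4.5,
  §4 (rank), §5 (`⟨k,m,n⟩`). [Blaser2013]
* J. Krajíček, *Proof Complexity*, CUP 2019, §6.2 (Nullstellensatz refutations and their degree).
  [KrajicekProofComplexity2019]
-/

noncomputable section

open MvPolynomial Finset
open Literature.Computability.Complexity

namespace Literature.Computability.AlgebraicComplexity

universe u

/-! ## Padding triad decompositions -/

section Padding

variable {K : Type u} [CommSemiring K] {ι κ μ : Type*}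

/-- A triad with first factor `0` vanishes. [folklore] -/
theorem triad_zero_left (u : κ → K) (v : μ → K) : triad (0 : ι → K) u v = 0 := by
  funext a b c; simp [triad]

/-- **Padding**: a decomposition into `R` triads gives one into `r ≥ R` triads (add zero triads);
so the set `{r | t is a sum of r triads}` defining `tensorRank` is upward closed. [cite: Blaser2013, §4] -/
theorem exists_eq_sum_triad_of_le {t : ι → κ → μ → K} {R r : ℕ} (hRr : R ≤ r)
    (w : Fin R → ι → K) (u : Fin R → κ → K) (v : Fin R → μ → K)
    (h : t = ∑ i, triad (w i) (u i) (v i)) :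
    ∃ (w' : Fin r → ι → K) (u' : Fin r → κ → K) (v' : Fin r → μ → K),
      t = ∑ s, triad (w' s) (u' s) (v' s) := by
  classical
  let w' : Fin r → ι → K := fun s => if hs : (s : ℕ) < R then w ⟨s, hs⟩ else 0
  let u' : Fin r → κ → K := fun s => if hs : (s : ℕ) < R then u ⟨s, hs⟩ else 0
  let v' : Fin r → μ → K := fun s => if hs : (s : ℕ) < R then v ⟨s, hs⟩ else 0
  refine ⟨w', u', v', ?_⟩
  have hmap : ∑ s ∈ (univ : Finset (Fin R)).map (Fin.castLEEmb hRr), triad (w' s) (u' s) (v' s) =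
      ∑ i, triad (w i) (u i) (v i) := by
    rw [sum_map]
    refine sum_congr rfl fun i _ => ?_
    simp [w', u', v', Fin.castLEEmb, i.isLt]
  rw [h, ← hmap]
  refine (sum_subset (subset_univ _) fun s _ hs => ?_)
  have hsR : ¬ (s : ℕ) < R := fun hlt =>
    hs (mem_map.2 ⟨⟨s, hlt⟩, mem_univ _, Fin.ext rfl⟩)
  simp [w', hsR, triad_zero_left]

/-- For finite index types: `R(t) ≤ r` iff `t` is a sum of (exactly) `r` triads (the infimum is
attained, `exists_triad_decomposition_tensorRank`, then pad). [cite: Blaser2013, §4] -/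
theorem tensorRank_le_iff [Fintype ι] [Fintype κ] [Fintype μ] (t : ι → κ → μ → K) (r : ℕ) :
    tensorRank t ≤ r ↔ ∃ (w : Fin r → ι → K) (u : Fin r → κ → K) (v : Fin r → μ → K),
      t = ∑ s, triad (w s) (u s) (v s) := by
  constructor
  · intro h
    obtain ⟨w, u, v, hdec⟩ := exists_triad_decomposition_tensorRank t
    exact exists_eq_sum_triad_of_le h w u v hdec
  · rintro ⟨w, u, v, h⟩
    exact tensorRank_le_of_eq_sum w u v h

end Padding

/-! ## The Brent system `B(n, r)` -/

section Brent

variable (K : Type u) [CommRing K]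

/-- **The Brent system `B(n, r)`** (Brent 1970; Heule–Kauers–Seidl 2021, §2 "the Brent
equations": `∑_{ℓ=1}^{r} α^{(ℓ)}_{i₁i₂} β^{(ℓ)}_{j₁j₂} γ^{(ℓ)}_{k₁k₂} = δδδ`, "`n⁶` cubic equations"
in `3rn²` unknowns): the polynomial system expressing that the matrix multiplication tensor
`⟨n,n,n⟩` (`matMulTensor K n n n`, Bläser 2013 §5) is a sum of `r` triads
`∑_{t<r} a_t ⊗ b_t ⊗ c_t` (Bläser 2013, Def. 4.5 and the definition of `R(t)`). Unknowns:
`X (0, t, i) = a_{t,i}`, `X (1, t, j) = b_{t,j}`, `X (2, t, k) = c_{t,k}` for `t : Fin r` and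
`i, j, k : Fin n × Fin n`; the equation indexed `(i, j, k)` is
`∑_{t<r} X(0,t,i) X(1,t,j) X(2,t,k) - ⟨n,n,n⟩_{ijk}`. This is, verbatim, the expression inlined by
the items of route MatrixMultiplication/BrentRefutationDepth. [cite: HeuleKauersSeidl2021, §2 (the Brent equations)] -/
def brentSystem (n r : ℕ) :
    (Fin n × Fin n) → (Fin n × Fin n) → (Fin n × Fin n) →
      MvPolynomial (Fin 3 × Fin r × (Fin n × Fin n)) K :=
  fun i j k => (∑ t : Fin r, MvPolynomial.X ((0 : Fin 3), t, i) * MvPolynomial.X ((1 : Fin 3), t, j) *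
    MvPolynomial.X ((2 : Fin 3), t, k)) - MvPolynomial.C (matMulTensor K n n n i j k)

/-- `brentSystem` unfolds (definitionally the route's inline expression). [folklore] -/
theorem brentSystem_apply (n r : ℕ) (i j k : Fin n × Fin n) :
    brentSystem K n r i j k = (∑ t : Fin r, MvPolynomial.X ((0 : Fin 3), t, i) *
      MvPolynomial.X ((1 : Fin 3), t, j) * MvPolynomial.X ((2 : Fin 3), t, k)) -
      MvPolynomial.C (matMulTensor K n n n i j k) := rfl

variable {K}

/-- **Zeros of `B(n, r)` are rank-`r` decompositions**: at any point `x`, the Brent polynomial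
`(i, j, k)` evaluates to `(∑_t a_t ⊗ b_t ⊗ c_t - ⟨n,n,n⟩)_{ijk}` with `a_t = x(0,t,·)`,
`b_t = x(1,t,·)`, `c_t = x(2,t,·)`. [cite: HeuleKauersSeidl2021, §2 (the Brent equations)] -/
theorem eval_brentSystem {n r : ℕ} (x : Fin 3 × Fin r × (Fin n × Fin n) → K)
    (i j k : Fin n × Fin n) :
    eval x (brentSystem K n r i j k) =
      (∑ t : Fin r, triad (fun i => x (0, t, i)) (fun j => x (1, t, j)) (fun k => x (2, t, k))) i j k
        - matMulTensor K n n n i j k := by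
  simp [brentSystem, Finset.sum_apply, triad]

/-- Hence a common zero of `B(n, r)` gives `R(⟨n,n,n⟩) ≤ r` ("the problem boils down to finding a
solution of the Brent equations", Heule–Kauers–Seidl §2). [cite: HeuleKauersSeidl2021, §2 (the Brent equations)] -/
theorem tensorRank_le_of_eval_brentSystem_eq_zero {n r : ℕ}
    (x : Fin 3 × Fin r × (Fin n × Fin n) → K) (hx : ∀ i j k, eval x (brentSystem K n r i j k) = 0) :
    tensorRank (matMulTensor K n n n) ≤ r := by
  refine tensorRank_le_of_eq_sum (fun t i => x (0, t, i)) (fun t j => x (1, t, j))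
    (fun t k => x (2, t, k)) ?_
  funext i j k
  have h := hx i j k
  rw [eval_brentSystem] at h
  exact (sub_eq_zero.1 h).symm

/-- The point of `K^{3 × r × n²}` encoding a family of `r` triples `(a_t, b_t, c_t)`. [folklore] -/
def brentPoint {n r : ℕ} (w u v : Fin r → (Fin n × Fin n) → K) :
    Fin 3 × Fin r × (Fin n × Fin n) → K :=
  fun p => ![w p.2.1 p.2.2, u p.2.1 p.2.2, v p.2.1 p.2.2] p.1

/-- Conversely a decomposition `⟨n,n,n⟩ = ∑_{t<r} a_t ⊗ b_t ⊗ c_t` is a common zero of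
`B(n, r)`. [cite: HeuleKauersSeidl2021, §2 (the Brent equations)] -/
theorem eval_brentSystem_brentPoint_eq_zero {n r : ℕ} {w u v : Fin r → (Fin n × Fin n) → K}
    (h : matMulTensor K n n n = ∑ t, triad (w t) (u t) (v t)) (i j k : Fin n × Fin n) :
    eval (brentPoint w u v) (brentSystem K n r i j k) = 0 := by
  rw [eval_brentSystem, sub_eq_zero, h]
  rfl

/-- **`B(n, r)` is solvable over `K` iff `R_K(⟨n,n,n⟩) ≤ r`** (Brent 1970; Heule–Kauers–Seidl
§2; Bläser 2013 §4–5: rank = least number of triads). [cite: HeuleKauersSeidl2021, §2 (the Brent equations)] -/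
theorem tensorRank_le_iff_exists_brent_zero (n r : ℕ) :
    tensorRank (matMulTensor K n n n) ≤ r ↔
      ∃ x : Fin 3 × Fin r × (Fin n × Fin n) → K, ∀ i j k, eval x (brentSystem K n r i j k) = 0 := by
  constructor
  · intro h
    obtain ⟨w, u, v, hdec⟩ := (tensorRank_le_iff _ r).1 h
    exact ⟨brentPoint w u v, eval_brentSystem_brentPoint_eq_zero hdec⟩
  · rintro ⟨x, hx⟩
    exact tensorRank_le_of_eval_brentSystem_eq_zero x hx

/-! ## Nullstellensatz refutations of `B(n, r)`: the refutation depth predicate -/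

variable (K)

/-- **`B(n, r)` has a Nullstellensatz refutation with multipliers of total degree `≤ D`**
(`D_NS(n, r) ≤ D` in the language of route BrentRefutationDepth): the tree's
`HasNSRefutationWithMultipliersOfDegree` (Krajíček, *Proof Complexity* §6.2, multiplier-degree
convention) applied to the Brent system indexed by triples `(i, j, k)`.
[cite: KrajicekProofComplexity2019, §6.2] -/
def HasBrentRefutation (n r D : ℕ) : Prop :=
  HasNSRefutationWithMultipliersOfDegree
    (fun e : (Fin n × Fin n) × (Fin n × Fin n) × (Fin n × Fin n) =>
      brentSystem K n r e.1 e.2.1 e.2.2) D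

/-- **The route's inline form**: `HasBrentRefutation K n r D` iff there are curried multipliers
`g i j k` of total degree `≤ D` with `∑ i, ∑ j, ∑ k, g i j k * B_{ijk} = 1` — after unfolding
`brentSystem`, literally the shape of the items of MatrixMultiplication/BrentRefutationDepth
(`TwoBySixDepth` = `HasBrentRefutation ℂ 2 6 12`, `RefutationSound`, `NSDepthLowerBound`, …).
[folklore] -/
theorem hasBrentRefutation_iff (n r D : ℕ) :
    HasBrentRefutation K n r D ↔
      ∃ g : (Fin n × Fin n) → (Fin n × Fin n) → (Fin n × Fin n) →
          MvPolynomial (Fin 3 × Fin r × (Fin n × Fin n)) K,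
        (∀ i j k, (g i j k).totalDegree ≤ D) ∧
          (∑ i, ∑ j, ∑ k, g i j k * brentSystem K n r i j k) = 1 := by
  rw [HasBrentRefutation, hasNSRefutationWithMultipliersOfDegree_iff_forall]
  constructor
  · rintro ⟨g, hdeg, hsum⟩
    refine ⟨fun i j k => g (i, j, k), fun i j k => hdeg _, ?_⟩
    rw [← hsum, Fintype.sum_prod_type]
    simp_rw [Fintype.sum_prod_type]
  · rintro ⟨g, hdeg, hsum⟩
    refine ⟨fun e => g e.1 e.2.1 e.2.2, fun e => hdeg _ _ _, ?_⟩
    rw [← hsum, Fintype.sum_prod_type]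
    simp_rw [Fintype.sum_prod_type]

variable {K}

/-- Monotonicity in the degree bound. [folklore] -/
theorem HasBrentRefutation.mono {n r D D' : ℕ} (h : HasBrentRefutation K n r D) (hD : D ≤ D') :
    HasBrentRefutation K n r D' :=
  HasNSRefutationWithMultipliersOfDegree.mono h hD

/-- **Soundness of Nullstellensatz refutations** (the trivial direction of Hilbert's
Nullstellensatz; Krajíček §6.2): if `∑ g_a 𝒜_a = 1` then the axioms `𝒜_a` have no common zero over
(the nontrivial ring) `K` — evaluate the identity at a purported zero: `0 = 1`.
[cite: KrajicekProofComplexity2019, §6.2] -/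
theorem _root_.Literature.Computability.Complexity.HasNSRefutationWithMultipliersOfDegree.exists_eval_ne_zero
    [Nontrivial K] {ι σ : Type*} {𝒜 : ι → MvPolynomial σ K} {D : ℕ}
    (h : HasNSRefutationWithMultipliersOfDegree 𝒜 D) (x : σ → K) :
    ∃ a, eval x (𝒜 a) ≠ 0 := by
  obtain ⟨s, g, hsum, -⟩ := h
  by_contra hall
  push Not at hall
  have h1 := congrArg (eval x) hsum
  rw [map_sum, map_one] at h1
  simp [map_mul, hall] at h1

/-- **Refutations certify rank lower bounds** (route item `RefutationSound`, the glue of the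
Assembly): an NS refutation of `B(n, r)` over a nontrivial `K` shows `R_K(⟨n,n,n⟩) > r` — if
`R ≤ r`, pad an optimal decomposition to `r` triads (`tensorRank_le_iff`), which is a common zero
of `B(n, r)`, and evaluate `∑ g·B = 1` there. [cite: HeuleKauersSeidl2021, §2 (the Brent equations)] -/
theorem HasBrentRefutation.lt_tensorRank [Nontrivial K] {n r D : ℕ}
    (h : HasBrentRefutation K n r D) : r < tensorRank (matMulTensor K n n n) := by
  by_contra hle
  push Not at hle
  obtain ⟨x, hx⟩ := (tensorRank_le_iff_exists_brent_zero n r).1 hle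
  obtain ⟨e, he⟩ := h.exists_eval_ne_zero x
  exact he (hx _ _ _)

/-- No refutation of a solvable system: if `R_K(⟨n,n,n⟩) ≤ r` then `B(n, r)` has no NS refutation
in any degree. [cite: HeuleKauersSeidl2021, §2 (the Brent equations)] -/
theorem not_hasBrentRefutation_of_tensorRank_le [Nontrivial K] {n r : ℕ}
    (h : tensorRank (matMulTensor K n n n) ≤ r) (D : ℕ) : ¬ HasBrentRefutation K n r D :=
  fun hB => (Nat.lt_irrefl r) (lt_of_lt_of_le hB.lt_tensorRank h)

end Brent

/-! ## The size of the system (HKS 2021, §2: "`621` variables and `729` cubic equations") -/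

section Counts

/-- **The Brent system `B(n, r)` has `n⁶` equations** (they are indexed by
`(i, j, k) ∈ ((Fin n × Fin n))³`; HKS §2: "for `i₁,i₂,j₁,j₂,k₁,k₂ ∈ {1,2,3}`").
[cite: HeuleKauersSeidl2021, §2 (the Brent equations)] -/
theorem card_brentSystem_equations (n : ℕ) :
    Fintype.card ((Fin n × Fin n) × (Fin n × Fin n) × (Fin n × Fin n)) = n ^ 6 := by
  simp only [Fintype.card_prod, Fintype.card_fin]
  ring

/-- **… in `3 r n²` unknowns** (`α^{(ℓ)}_{i₁i₂}, β^{(ℓ)}_{j₁j₂}, γ^{(ℓ)}_{k₁k₂}`, `ℓ ≤ r`; the variables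
`Fin 3 × Fin r × (Fin n × Fin n)` of `brentSystem K n r`).
[cite: HeuleKauersSeidl2021, §2 (the Brent equations)] -/
theorem card_brentSystem_unknowns (n r : ℕ) :
    Fintype.card (Fin 3 × Fin r × (Fin n × Fin n)) = 3 * r * n ^ 2 := by
  simp only [Fintype.card_prod, Fintype.card_fin]
  ring

/-- **HKS §2, verbatim: for `3 × 3`-matrices and `23` multiplications "there are `621` variables and
`729` cubic equations."** [cite: HeuleKauersSeidl2021, §2 (the Brent equations)] -/
theorem heuleKauersSeidl2021_brent_counts :
    Fintype.card (Fin 3 × Fin 23 × (Fin 3 × Fin 3)) = 621 ∧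
      Fintype.card ((Fin 3 × Fin 3) × (Fin 3 × Fin 3) × (Fin 3 × Fin 3)) = 729 :=
  ⟨card_brentSystem_unknowns 3 23, card_brentSystem_equations 3⟩

end Counts

end Literature.Computability.AlgebraicComplexity
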